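/-
Copyright (c) 2026 the pub-hodgecm-mathlib formalisation cell (harness21).  Prover seat hodgecm-mathlib-K2E3-p11 (g5), Track B «K2-LIT» ∕ h413
(`stmt-HodgeConjecture-24833`), line `K2_E3_EllipticInputs`, unit U12 §L, Richardson road for (LBGL-ge3) at `N = 3` (road owner K2E3-p11), brick (F-E) =
(LBGL-3E) «THE (2,1)-PARABOLIC SLICE DENSITY OF 𝔤𝔩₃(F)», FILE H″3b «THE LOCAL DENSITY AT A SPLIT REGULAR POINT: three pieces».  2026-09-04.
-/
import Summits.HodgeConjecture.HodgeConjecture.Theorems.K2E3GL3ParabolicSlicePieceTransport   -- ★ H″3a (this seat): `lintegral_levelSet_row_eq_of_transport`, `not_two_rows_deep_of_mem_glInt`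
import Summits.HodgeConjecture.HodgeConjecture.Theorems.K2E3GL3ParabolicFibreExhaustion       -- ★ EXHAUST p857815 (K2E3-p21 g4): `exists_level_of_conj_mem_box_diagonal`
import Summits.HodgeConjecture.HodgeConjecture.Theorems.K2E3GL3ParabolicNilTwist              -- ★ A′ p857618 (K2E3-p21 g4): `eval_charpoly_fin_two`
import HarnessLib

/-!
# K2_E3 road (h413), §L ∕ Richardson road at `N = 3`, brick (F-E) FILE H″3b: the local density at a split regular point `diag(d)`

Cell `pub/hodgecm-mathlib` (D-0151), Track B, seat K2E3-p11 (g5) (road owner of (F-E) = (LBGL-3E) `sig_K2E3GL3ParabolicSliceDensity`; ROAD v2 on `K2/STATUS.md`,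
2026-09-04).  `--supports stmt-HodgeConjecture-24833 --as helper`; THEOREMS ONLY (no definition ∕ instance ∕ notation ∕ named fact ∕ `sorry`); never imports
`Cruxes/…/Lines`.  COUNT-NEUTRAL.

THE POINT.  At `diag(d)` with `d` injective the (2,1)-parabolic slice `ρ(h) = ∫_K ∫_𝔭 h(Ad(k)P) dP dk` sees THREE fibre pieces: by ★ EXHAUST (b), `Ad(k)P ∈ B_J = diag(d) +
M₃(𝔭^J)` forces row `a` of `k` to have its first two entries in `𝔭^{J−c}` for some `a ∈ {0, 1, 2}`; the three level sets are disjoint (★ H″3a) and each is a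
transported ball piece (★ H″3a, with `w = 1`, `W₀ = [[0,0,1],[0,1,0],[1,0,0]]`, `W₁ = [[1,0,0],[0,0,1],[0,1,0]]` and Levi data `diag(d∘σ)`).  Hence, with the constant
`C` of the ball-piece formula (★ H″1; hypothesis `hball`),
  `ρ(1_{B_J}·h) = C · ( ‖(d₀−d₁)(d₀−d₂)‖⁻¹ + ‖(d₁−d₀)(d₁−d₂)‖⁻¹ + ‖(d₂−d₀)(d₂−d₁)‖⁻¹ ) · ∫⁻_{B_J} h dμ𝔤`     (deep `J`, measurable `h ≥ 0`),
the weight being `Σ_{roots λ} ‖χ'_{diag d}(λ)‖⁻¹`.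
* §1 the permutation matrices `W₀, W₁` (membership in `GL₃(𝒪)`, row identity, conjugation identity);  §2 **`lintegral_parabolicSlice_ball_indicator_eq_diagonal`**.
[HarishChandra1999AdmissibleDistributions, §7 Lemma 7.8] [HarishChandra1970, Part V §4 Lemma 22]
HONEST LABEL: HC_CM is proved only modulo the 7 printed citations (2 remaining named inputs: hLiu418 = stmt-HodgeConjecture-24832, h413 = stmt-HodgeConjecture-24833)
until rung 0 closes; count-neutral helper ((LBGL-ge3)∕(LBGL-3E) NOT ★ here).

## References
* [HarishChandra1999AdmissibleDistributions] Harish-Chandra (DeBacker–Sally), *Admissible Invariant Distributions on Reductive p-adic Groups* (1999), §7, Lemma 7.8.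
* [HarishChandra1970] Harish-Chandra (van Dijk), *Harmonic Analysis on Reductive p-adic Groups*, LNM 162 (1970), Part V §4 Lemma 22.
-/

set_option autoImplicit false
set_option linter.dupNamespace false

noncomputable section

open MeasureTheory Measure Filter Topology Set Matrix ValuativeRel
open scoped MatrixGroups NNReal ENNReal
open Literature.NumberTheory.Automorphic Literature.NumberTheory.Automorphic.LocalFieldHaar
open Literature.NumberTheory.GaloisRepresentations Literature.NumberTheory.GaloisRepresentations.IsNonarchimedeanLocalField
open Summit.HodgeConjecture.HodgeConjecture.Cruxes.H413.K2E3GL3ParabolicSlicePieceTransport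

namespace Summit.HodgeConjecture.HodgeConjecture.Cruxes.H413.K2E3GL3ParabolicSliceLocalDensityDiagonal

/-! ## §1  The permutation matrices -/

section Perm

variable {F : Type*} [Field F]

/-- `W₀² = 1`. [folklore] -/
theorem W0_mul_W0 : (!![0, 0, 1; 0, 1, 0; 1, 0, 0] : Matrix (Fin 3) (Fin 3) F) * (!![0, 0, 1; 0, 1, 0; 1, 0, 0] : Matrix (Fin 3) (Fin 3) F) = 1 := by
  ext i l; fin_cases i <;> fin_cases l <;> simp [Matrix.mul_apply, Fin.sum_univ_three]

/-- `W₁² = 1`. [folklore] -/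
theorem W1_mul_W1 : (!![1, 0, 0; 0, 0, 1; 0, 1, 0] : Matrix (Fin 3) (Fin 3) F) * (!![1, 0, 0; 0, 0, 1; 0, 1, 0] : Matrix (Fin 3) (Fin 3) F) = 1 := by
  ext i l; fin_cases i <;> fin_cases l <;> simp [Matrix.mul_apply, Fin.sum_univ_three]

/-- `W₀ X W₀` swaps the indices `0 ↔ 2`. [folklore] -/
theorem W0_conj (X : Matrix (Fin 3) (Fin 3) F) :
    (!![0, 0, 1; 0, 1, 0; 1, 0, 0] : Matrix (Fin 3) (Fin 3) F) * X * (!![0, 0, 1; 0, 1, 0; 1, 0, 0] : Matrix (Fin 3) (Fin 3) F) =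
      !![X 2 2, X 2 1, X 2 0; X 1 2, X 1 1, X 1 0; X 0 2, X 0 1, X 0 0] := by
  ext i l; fin_cases i <;> fin_cases l <;> simp [Matrix.mul_apply, Fin.sum_univ_three, Matrix.vecMul, dotProduct]

/-- `W₁ X W₁` swaps the indices `1 ↔ 2`. [folklore] -/
theorem W1_conj (X : Matrix (Fin 3) (Fin 3) F) :
    (!![1, 0, 0; 0, 0, 1; 0, 1, 0] : Matrix (Fin 3) (Fin 3) F) * X * (!![1, 0, 0; 0, 0, 1; 0, 1, 0] : Matrix (Fin 3) (Fin 3) F) =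
      !![X 0 0, X 0 2, X 0 1; X 2 0, X 2 2, X 2 1; X 1 0, X 1 2, X 1 1] := by
  ext i l; fin_cases i <;> fin_cases l <;> simp [Matrix.mul_apply, Fin.sum_univ_three, Matrix.vecMul, dotProduct]

/-- Conjugation identity for `W₀`: `W₀ X W₀ − diag d ∈ M₃(S) ↔ X − diag(d₂, d₁, d₀) ∈ M₃(S)`. [folklore] -/
theorem forall_W0_conj_sub_diagonal_iff (d : Fin 3 → F) (X : Matrix (Fin 3) (Fin 3) F) (S : Set F) :
    (∀ i l, ((!![0, 0, 1; 0, 1, 0; 1, 0, 0] : Matrix (Fin 3) (Fin 3) F) * X * (!![0, 0, 1; 0, 1, 0; 1, 0, 0] : Matrix (Fin 3) (Fin 3) F) - Matrix.diagonal d) i l ∈ S) ↔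
      (∀ i l, (X - !![d 2, 0, 0; 0, d 1, 0; 0, 0, d 0]) i l ∈ S) := by
  rw [W0_conj]
  have hd : Matrix.diagonal d = !![d 0, 0, 0; 0, d 1, 0; 0, 0, d 2] := by ext i l; fin_cases i <;> fin_cases l <;> simp
  rw [hd]
  constructor
  · intro h i l
    fin_cases i <;> fin_cases l
    · simpa using h 2 2
    · simpa using h 2 1
    · simpa using h 2 0
    · simpa using h 1 2
    · simpa using h 1 1
    · simpa using h 1 0
    · simpa using h 0 2
    · simpa using h 0 1
    · simpa using h 0 0
  · intro h i l
    fin_cases i <;> fin_cases l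
    · simpa using h 2 2
    · simpa using h 2 1
    · simpa using h 2 0
    · simpa using h 1 2
    · simpa using h 1 1
    · simpa using h 1 0
    · simpa using h 0 2
    · simpa using h 0 1
    · simpa using h 0 0

/-- Conjugation identity for `W₁`: `W₁ X W₁ − diag d ∈ M₃(S) ↔ X − diag(d₀, d₂, d₁) ∈ M₃(S)`. [folklore] -/
theorem forall_W1_conj_sub_diagonal_iff (d : Fin 3 → F) (X : Matrix (Fin 3) (Fin 3) F) (S : Set F) :
    (∀ i l, ((!![1, 0, 0; 0, 0, 1; 0, 1, 0] : Matrix (Fin 3) (Fin 3) F) * X * (!![1, 0, 0; 0, 0, 1; 0, 1, 0] : Matrix (Fin 3) (Fin 3) F) - Matrix.diagonal d) i l ∈ S) ↔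
      (∀ i l, (X - !![d 0, 0, 0; 0, d 2, 0; 0, 0, d 1]) i l ∈ S) := by
  rw [W1_conj]
  have hd : Matrix.diagonal d = !![d 0, 0, 0; 0, d 1, 0; 0, 0, d 2] := by ext i l; fin_cases i <;> fin_cases l <;> simp
  rw [hd]
  constructor
  · intro h i l
    fin_cases i <;> fin_cases l
    · simpa using h 0 0
    · simpa using h 0 2
    · simpa using h 0 1
    · simpa using h 2 0
    · simpa using h 2 2
    · simpa using h 2 1
    · simpa using h 1 0
    · simpa using h 1 2
    · simpa using h 1 1
  · intro h i l
    fin_cases i <;> fin_cases l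
    · simpa using h 0 0
    · simpa using h 0 2
    · simpa using h 0 1
    · simpa using h 2 0
    · simpa using h 2 2
    · simpa using h 2 1
    · simpa using h 1 0
    · simpa using h 1 2
    · simpa using h 1 1

/-- The trivial conjugation identity: `X − diag d ∈ M₃(S) ↔ X − [[d₀,0,0],[0,d₁,0],[0,0,d₂]] ∈ M₃(S)`. [folklore] -/
theorem forall_one_conj_sub_diagonal_iff (d : Fin 3 → F) (X : Matrix (Fin 3) (Fin 3) F) (S : Set F) :
    (∀ i l, ((1 : Matrix (Fin 3) (Fin 3) F) * X * (1 : Matrix (Fin 3) (Fin 3) F) - Matrix.diagonal d) i l ∈ S) ↔ (∀ i l, (X - !![d 0, 0, 0; 0, d 1, 0; 0, 0, d 2]) i l ∈ S) := by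
  have hd : Matrix.diagonal d = !![d 0, 0, 0; 0, d 1, 0; 0, 0, d 2] := by ext i l; fin_cases i <;> fin_cases l <;> simp
  rw [Matrix.one_mul, Matrix.mul_one, hd]

variable [ValuativeRel F]

/-- A self-inverse integral matrix lies in `GL₃(𝒪)`: packaged for `W₀`, `W₁`. [folklore] -/
theorem exists_glInt_of_mul_self {W : Matrix (Fin 3) (Fin 3) F} (hW : W * W = 1) (hint : ∀ i l, W i l ∈ 𝒪[F]) :
    ∃ w : GL (Fin 3) F, w ∈ glInt 3 F ∧ (w : Matrix (Fin 3) (Fin 3) F) = W ∧ ((w⁻¹ : GL (Fin 3) F) : Matrix (Fin 3) (Fin 3) F) = W := by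
  refine ⟨⟨W, W, hW, hW⟩, ?_, rfl, rfl⟩
  rw [mem_glInt_iff]
  exact ⟨hint, hint⟩

/-- `W₀ ∈ GL₃(𝒪)` with `W₀⁻¹ = W₀`. [folklore] -/
theorem exists_glInt_W0 : ∃ w : GL (Fin 3) F, w ∈ glInt 3 F ∧ (w : Matrix (Fin 3) (Fin 3) F) = !![0, 0, 1; 0, 1, 0; 1, 0, 0] ∧
    ((w⁻¹ : GL (Fin 3) F) : Matrix (Fin 3) (Fin 3) F) = !![0, 0, 1; 0, 1, 0; 1, 0, 0] :=
  exists_glInt_of_mul_self W0_mul_W0 (fun i l => by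
    fin_cases i <;> fin_cases l <;> simp)

/-- `W₁ ∈ GL₃(𝒪)` with `W₁⁻¹ = W₁`. [folklore] -/
theorem exists_glInt_W1 : ∃ w : GL (Fin 3) F, w ∈ glInt 3 F ∧ (w : Matrix (Fin 3) (Fin 3) F) = !![1, 0, 0; 0, 0, 1; 0, 1, 0] ∧
    ((w⁻¹ : GL (Fin 3) F) : Matrix (Fin 3) (Fin 3) F) = !![1, 0, 0; 0, 0, 1; 0, 1, 0] :=
  exists_glInt_of_mul_self W1_mul_W1 (fun i l => by
    fin_cases i <;> fin_cases l <;> simp)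

end Perm

/-! ## §2  The local density at `diag(d)` -/

section Main

variable {F : Type*} [Field F] [ValuativeRel F] [TopologicalSpace F] [IsNonarchimedeanLocalField F]
  [MeasurableSpace F] [BorelSpace F]
  [MeasurableSpace (Matrix (Fin 3) (Fin 3) F)] [BorelSpace (Matrix (Fin 3) (Fin 3) F)]
  [MeasurableSpace (GL (Fin 3) F)] [BorelSpace (GL (Fin 3) F)]

/-- **THE LOCAL DENSITY AT A SPLIT REGULAR POINT.**  `κ` a Haar measure on `K = GL₃(𝒪)`, `dx`, `μ𝔤` additive Haar measures, `C` a constant for which the BALL PIECE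
FORMULA `hball` holds (★ H″1), `d` injective.  For all deep `J` and measurable `h ≥ 0`:
`∫⁻_K ∫⁻_{F⁷} (1_{B_J}·h)(k·P(r)·k⁻¹) dr dκ = C · (‖(d₀−d₂)(d₀−d₁)‖⁻¹ + ‖(d₁−d₀)(d₁−d₂)‖⁻¹ + ‖(d₂−d₀)(d₂−d₁)‖⁻¹) · ∫⁻_{B_J} h dμ𝔤`, `B_J = diag(d) + M₃(𝔭^J)` — three
disjoint level-set pieces (★ EXHAUST (b), ★ H″3a), each a transported ball piece. [cite: HarishChandra1999AdmissibleDistributions, §7 Lemma 7.8]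
[cite: HarishChandra1970, Part V §4 Lemma 22] -/
theorem lintegral_parabolicSlice_ball_indicator_eq_diagonal
    (κ : Measure ↥(glInt 3 F)) [IsHaarMeasure κ] (dx : Measure F) (μ𝔤 : Measure (Matrix (Fin 3) (Fin 3) F)) [μ𝔤.IsAddHaarMeasure] (C : ℝ≥0∞)
    (hball : ∀ m : Fin 5 → F, (!![m 0, m 1; m 2, m 3] : Matrix (Fin 2) (Fin 2) F).charpoly.eval (m 4) ≠ 0 →
      ∃ j₀ c₁ : ℕ, ∀ j' J : ℕ, j₀ ≤ j' → j' + c₁ ≤ J → ∀ h : Matrix (Fin 3) (Fin 3) F → ℝ≥0∞, Measurable h →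
        ∫⁻ k in {k : ↥(glInt 3 F) | ((k : GL (Fin 3) F) : Matrix (Fin 3) (Fin 3) F) 2 0 ∈ primePowBall F j' ∧
            ((k : GL (Fin 3) F) : Matrix (Fin 3) (Fin 3) F) 2 1 ∈ primePowBall F j'},
          ∫⁻ r : Fin 7 → F,
            ({X : Matrix (Fin 3) (Fin 3) F | ∀ i l, (X - !![m 0, m 1, 0; m 2, m 3, 0; 0, 0, m 4]) i l ∈ primePowBall F (J : ℤ)}).indicator h
              (((k : GL (Fin 3) F) : Matrix (Fin 3) (Fin 3) F) * !![r 0, r 1, r 2; r 3, r 4, r 5; 0, 0, r 6] *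
                ((((k : GL (Fin 3) F))⁻¹ : GL (Fin 3) F) : Matrix (Fin 3) (Fin 3) F))
            ∂(Measure.pi fun _ : Fin 7 => dx) ∂κ =
          C * ((normAbs F ((!![m 0, m 1; m 2, m 3] : Matrix (Fin 2) (Fin 2) F).charpoly.eval (m 4)))⁻¹ : ℝ≥0) *
            ∫⁻ X in {X : Matrix (Fin 3) (Fin 3) F | ∀ i l, (X - !![m 0, m 1, 0; m 2, m 3, 0; 0, 0, m 4]) i l ∈ primePowBall F (J : ℤ)}, h X ∂μ𝔤)
    (d : Fin 3 → F) (hd : Function.Injective d) :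
    ∃ J₀ : ℕ, ∀ J : ℕ, J₀ ≤ J → ∀ h : Matrix (Fin 3) (Fin 3) F → ℝ≥0∞, Measurable h →
      ∫⁻ k : ↥(glInt 3 F), ∫⁻ r : Fin 7 → F,
          ({X : Matrix (Fin 3) (Fin 3) F | ∀ i l, (X - Matrix.diagonal d) i l ∈ primePowBall F (J : ℤ)}).indicator h
            (((k : GL (Fin 3) F) : Matrix (Fin 3) (Fin 3) F) * !![r 0, r 1, r 2; r 3, r 4, r 5; 0, 0, r 6] *
              ((((k : GL (Fin 3) F))⁻¹ : GL (Fin 3) F) : Matrix (Fin 3) (Fin 3) F))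
          ∂(Measure.pi fun _ : Fin 7 => dx) ∂κ =
        C * (((normAbs F ((d 0 - d 2) * (d 0 - d 1)))⁻¹ + (normAbs F ((d 1 - d 0) * (d 1 - d 2)))⁻¹ + (normAbs F ((d 2 - d 0) * (d 2 - d 1)))⁻¹ : ℝ≥0) : ℝ≥0∞) *
          ∫⁻ X in {X : Matrix (Fin 3) (Fin 3) F | ∀ i l, (X - Matrix.diagonal d) i l ∈ primePowBall F (J : ℤ)}, h X ∂μ𝔤 := by
  classical
  have h01 : d 0 - d 1 ≠ 0 := sub_ne_zero.2 (hd.ne (by decide))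
  have h02 : d 0 - d 2 ≠ 0 := sub_ne_zero.2 (hd.ne (by decide))
  have h12 : d 1 - d 2 ≠ 0 := sub_ne_zero.2 (hd.ne (by decide))
  have h10 : d 1 - d 0 ≠ 0 := sub_ne_zero.2 (hd.ne (by decide))
  have h20 : d 2 - d 0 ≠ 0 := sub_ne_zero.2 (hd.ne (by decide))
  have h21 : d 2 - d 1 ≠ 0 := sub_ne_zero.2 (hd.ne (by decide))
  -- the three Levi data `m₂ = (d₀,0,0,d₁,d₂)`, `m₀ = (d₂,0,0,d₁,d₀)`, `m₁ = (d₀,0,0,d₂,d₁)` and their `χ`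
  have hχ : ∀ x y z : F, (!![(![x, 0, 0, y, z] : Fin 5 → F) 0, (![x, 0, 0, y, z] : Fin 5 → F) 1;
      (![x, 0, 0, y, z] : Fin 5 → F) 2, (![x, 0, 0, y, z] : Fin 5 → F) 3] : Matrix (Fin 2) (Fin 2) F).charpoly.eval ((![x, 0, 0, y, z] : Fin 5 → F) 4) =
      (z - x) * (z - y) := by
    intro x y z
    rw [K2E3GL3ParabolicNilTwist.eval_charpoly_fin_two]
    simp
  have hm2 := hχ (d 0) (d 1) (d 2)
  have hm0 := hχ (d 2) (d 1) (d 0)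
  have hm1 := hχ (d 0) (d 2) (d 1)
  have hne2 : (!![(![d 0, 0, 0, d 1, d 2] : Fin 5 → F) 0, (![d 0, 0, 0, d 1, d 2] : Fin 5 → F) 1;
      (![d 0, 0, 0, d 1, d 2] : Fin 5 → F) 2, (![d 0, 0, 0, d 1, d 2] : Fin 5 → F) 3] : Matrix (Fin 2) (Fin 2) F).charpoly.eval ((![d 0, 0, 0, d 1, d 2] : Fin 5 → F) 4) ≠ 0 := by
    rw [hm2]; exact mul_ne_zero h20 h21
  have hne0 : (!![(![d 2, 0, 0, d 1, d 0] : Fin 5 → F) 0, (![d 2, 0, 0, d 1, d 0] : Fin 5 → F) 1;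
      (![d 2, 0, 0, d 1, d 0] : Fin 5 → F) 2, (![d 2, 0, 0, d 1, d 0] : Fin 5 → F) 3] : Matrix (Fin 2) (Fin 2) F).charpoly.eval ((![d 2, 0, 0, d 1, d 0] : Fin 5 → F) 4) ≠ 0 := by
    rw [hm0]; exact mul_ne_zero h02 h01
  have hne1 : (!![(![d 0, 0, 0, d 2, d 1] : Fin 5 → F) 0, (![d 0, 0, 0, d 2, d 1] : Fin 5 → F) 1;
      (![d 0, 0, 0, d 2, d 1] : Fin 5 → F) 2, (![d 0, 0, 0, d 2, d 1] : Fin 5 → F) 3] : Matrix (Fin 2) (Fin 2) F).charpoly.eval ((![d 0, 0, 0, d 2, d 1] : Fin 5 → F) 4) ≠ 0 := by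
    rw [hm1]; exact mul_ne_zero h10 h12
  -- the three transported pieces (★ H″3a)
  obtain ⟨w0, hw0, hw0c, hw0i⟩ := exists_glInt_W0 (F := F)
  obtain ⟨w1, hw1, hw1c, hw1i⟩ := exists_glInt_W1 (F := F)
  have hM2 : (!![(![d 0, 0, 0, d 1, d 2] : Fin 5 → F) 0, (![d 0, 0, 0, d 1, d 2] : Fin 5 → F) 1, 0;
      (![d 0, 0, 0, d 1, d 2] : Fin 5 → F) 2, (![d 0, 0, 0, d 1, d 2] : Fin 5 → F) 3, 0; 0, 0, (![d 0, 0, 0, d 1, d 2] : Fin 5 → F) 4] : Matrix (Fin 3) (Fin 3) F) =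
      !![d 0, 0, 0; 0, d 1, 0; 0, 0, d 2] := by
    ext i l; fin_cases i <;> fin_cases l <;> simp
  have hM0 : (!![(![d 2, 0, 0, d 1, d 0] : Fin 5 → F) 0, (![d 2, 0, 0, d 1, d 0] : Fin 5 → F) 1, 0;
      (![d 2, 0, 0, d 1, d 0] : Fin 5 → F) 2, (![d 2, 0, 0, d 1, d 0] : Fin 5 → F) 3, 0; 0, 0, (![d 2, 0, 0, d 1, d 0] : Fin 5 → F) 4] : Matrix (Fin 3) (Fin 3) F) =
      !![d 2, 0, 0; 0, d 1, 0; 0, 0, d 0] := by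
    ext i l; fin_cases i <;> fin_cases l <;> simp
  have hM1 : (!![(![d 0, 0, 0, d 2, d 1] : Fin 5 → F) 0, (![d 0, 0, 0, d 2, d 1] : Fin 5 → F) 1, 0;
      (![d 0, 0, 0, d 2, d 1] : Fin 5 → F) 2, (![d 0, 0, 0, d 2, d 1] : Fin 5 → F) 3, 0; 0, 0, (![d 0, 0, 0, d 2, d 1] : Fin 5 → F) 4] : Matrix (Fin 3) (Fin 3) F) =
      !![d 0, 0, 0; 0, d 2, 0; 0, 0, d 1] := by
    ext i l; fin_cases i <;> fin_cases l <;> simp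
  obtain ⟨j2, c2, hp2⟩ := lintegral_levelSet_row_eq_of_transport κ dx μ𝔤 C hball d 2 (![d 0, 0, 0, d 1, d 2]) hne2 1 (Subgroup.one_mem _)
    (fun k l => by rw [Units.val_one, Matrix.one_mul]) (fun X J => by
      rw [Units.val_one, inv_one, Units.val_one, hM2]; exact forall_one_conj_sub_diagonal_iff d X _)
  obtain ⟨j0, c0, hp0⟩ := lintegral_levelSet_row_eq_of_transport κ dx μ𝔤 C hball d 0 (![d 2, 0, 0, d 1, d 0]) hne0 w0 hw0
    (fun k l => by rw [hw0c]; simp [Matrix.mul_apply, Fin.sum_univ_three]) (fun X J => by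
      rw [hw0c, hw0i, hM0]; exact forall_W0_conj_sub_diagonal_iff d X _)
  obtain ⟨j1, c1, hp1⟩ := lintegral_levelSet_row_eq_of_transport κ dx μ𝔤 C hball d 1 (![d 0, 0, 0, d 2, d 1]) hne1 w1 hw1
    (fun k l => by rw [hw1c]; simp [Matrix.mul_apply, Fin.sum_univ_three]) (fun X J => by
      rw [hw1c, hw1i, hM1]; exact forall_W1_conj_sub_diagonal_iff d X _)
  -- ★ EXHAUST (b) and the common shift
  obtain ⟨c, J₀', hex⟩ := K2E3GL3ParabolicFibreExhaustion.exists_level_of_conj_mem_box_diagonal d hd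
  set cN : ℕ := max c.toNat (max c0 (max c1 c2)) with hcN
  set jm : ℕ := max 1 (max j0 (max j1 j2)) with hjm
  refine ⟨max J₀'.toNat (jm + cN), fun J hJ h hh => ?_⟩
  obtain ⟨j', hj'⟩ : ∃ j' : ℕ, j' + cN = J := ⟨J - cN, by omega⟩
  have hJ' : J₀' ≤ (J : ℤ) := by
    have : J₀'.toNat ≤ J := le_trans (le_max_left _ _) hJ
    omega
  have hcle : (j' : ℤ) ≤ (J : ℤ) - c := by
    have h1 : c ≤ (c.toNat : ℤ) := Int.self_le_toNat c
    have h2 : c.toNat ≤ cN := le_max_left _ _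
    omega
  have hj'1 : (1 : ℤ) ≤ j' := by
    have : 1 ≤ jm := le_max_left _ _
    omega
  set B : Set (Matrix (Fin 3) (Fin 3) F) := {X : Matrix (Fin 3) (Fin 3) F | ∀ i l, (X - Matrix.diagonal d) i l ∈ primePowBall F (J : ℤ)} with hB
  set S : Fin 3 → Set ↥(glInt 3 F) := fun a => {k : ↥(glInt 3 F) | ((k : GL (Fin 3) F) : Matrix (Fin 3) (Fin 3) F) a 0 ∈ primePowBall F j' ∧
      ((k : GL (Fin 3) F) : Matrix (Fin 3) (Fin 3) F) a 1 ∈ primePowBall F j'} with hS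
  have hSm : ∀ a, MeasurableSet (S a) := fun a => measurableSet_rowLevelSet (F := F) a j'
  have hSd : Pairwise (fun a b => Disjoint (S a) (S b)) := by
    intro a b hab
    rw [Set.disjoint_left]
    intro k hka hkb
    exact not_two_rows_deep_of_mem_glInt k.2 hab (primePowBall_antitone hj'1 hka.1) (primePowBall_antitone hj'1 hka.2)
      (primePowBall_antitone hj'1 hkb.1) (primePowBall_antitone hj'1 hkb.2)
  set Θ : ↥(glInt 3 F) → ℝ≥0∞ := fun k => ∫⁻ r : Fin 7 → F,
      B.indicator h (((k : GL (Fin 3) F) : Matrix (Fin 3) (Fin 3) F) * !![r 0, r 1, r 2; r 3, r 4, r 5; 0, 0, r 6] *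
        ((((k : GL (Fin 3) F))⁻¹ : GL (Fin 3) F) : Matrix (Fin 3) (Fin 3) F)) ∂(Measure.pi fun _ : Fin 7 => dx) with hΘ
  -- off the three level sets the integrand vanishes identically (★ EXHAUST (b))
  have hzero : ∀ k : ↥(glInt 3 F), k ∉ ⋃ a, S a → Θ k = 0 := by
    intro k hk
    rw [hΘ]; dsimp only
    have : ∀ r : Fin 7 → F, B.indicator h (((k : GL (Fin 3) F) : Matrix (Fin 3) (Fin 3) F) * !![r 0, r 1, r 2; r 3, r 4, r 5; 0, 0, r 6] *
        ((((k : GL (Fin 3) F))⁻¹ : GL (Fin 3) F) : Matrix (Fin 3) (Fin 3) F)) = 0 := by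
      intro r
      refine Set.indicator_of_notMem (fun hmem => hk ?_) _
      obtain ⟨a, ha0, ha1⟩ := hex (J : ℤ) hJ' (k : GL (Fin 3) F) k.2 (!![r 0, r 1, r 2; r 3, r 4, r 5; 0, 0, r 6]) (by simp) (by simp) hmem
      exact Set.mem_iUnion.2 ⟨a, primePowBall_antitone hcle ha0, primePowBall_antitone hcle ha1⟩
    simp only [this, lintegral_zero]
  have hunion : ∫⁻ k, Θ k ∂κ = ∫⁻ k in ⋃ a, S a, Θ k ∂κ := by
    rw [← lintegral_indicator (MeasurableSet.iUnion hSm)]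
    refine lintegral_congr fun k => ?_
    by_cases hk : k ∈ ⋃ a, S a
    · rw [Set.indicator_of_mem hk]
    · rw [Set.indicator_of_notMem hk, hzero k hk]
  change ∫⁻ k, Θ k ∂κ = _
  rw [hunion, lintegral_iUnion hSm hSd, tsum_fintype, Fin.sum_univ_three]
  have e0 := hp0 j' J (by omega) (by omega) h hh
  have e1 := hp1 j' J (by omega) (by omega) h hh
  have e2 := hp2 j' J (by omega) (by omega) h hh
  change ∫⁻ k in S 0, Θ k ∂κ = _ at e0
  change ∫⁻ k in S 1, Θ k ∂κ = _ at e1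
  change ∫⁻ k in S 2, Θ k ∂κ = _ at e2
  rw [e0, e1, e2, hm0, hm1, hm2]
  simp only [ENNReal.coe_add]
  ring

end Main

end Summit.HodgeConjecture.HodgeConjecture.Cruxes.H413.K2E3GL3ParabolicSliceLocalDensityDiagonal

end
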